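import Mathlib
import Summits.ResolutionOfSingularities.ResolutionOfSingularities.Theses.PAlteration
import Literature.AlgebraicGeometry.Resolution.ResolutionOfComponents

/-!
# ResolutionOfSingularities / pAlteration — `PicoverLocalModel`: normal forms of `a`
# (supports stmt-ResolutionOfSingularities-0557)

Route `pAlteration`, crux `PicoverLocalModel` (rank 5): resolution of the reduced local model
`X_a = Spec ((R[T]/(T^p - a))_red)`, `A_a := R[T]/(T^p - a) = AdjoinRoot (X^p - C a)`.

The local model only depends on `a` up to the natural moves on `α_p`-torsors / purely
inseparable hypersurfaces `t^p = a`, and every line of attack normalises `a` by them first: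

* **translation by `p`-th powers** (characteristic `p`): `A_a ≅ A_{a + b^p}` over `R`
  (`T ↦ T - b`, as `(T - b)^p = T^p - b^p`), `adjoinRootAlgEquivOfAddPow`;
* **scaling by powers of units** (any exponent `n`, any characteristic): `A_a ≅ A_{uⁿ a}` over
  `R` for a unit `u` (`T ↦ u⁻¹ T`), `adjoinRootAlgEquivOfUnitMul`;
* hence the reduced models are isomorphic and their resolution problems agree:
  `hasResolution_localModel_iff_of_addPow`, `hasResolution_localModel_iff_of_unitMul`
  (a ring isomorphism induces one modulo nilradicals).

So in the crux one may replace `a` by any representative of its class modulo `R^p` and modulo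
`p`-th powers of units (e.g. clear `p`-th-power factors, or arrange `a ∈ 𝔪` at a chosen point).
No statement item is restated.
-/

-- `Summit.<Summit>.<Sub>.Theorems` with `Sub = Summit` (single-conjunct summit, D-0017).
set_option linter.dupNamespace false

namespace Summit.ResolutionOfSingularities.ResolutionOfSingularities.Theorems

open Polynomial AlgebraicGeometry CategoryTheory Literature.AlgebraicGeometry.Resolution

universe u

/-! ## Reduced quotients along ring isomorphisms -/

section Reduced

/-- A ring isomorphism `A ≃ B` induces `A ⧸ nilradical A ≃ B ⧸ nilradical B`. [folklore] -/
theorem nonempty_quotientNilradical_equiv_of_ringEquiv {A B : Type u} [CommRing A] [CommRing B]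
    (e : A ≃+* B) : Nonempty ((A ⧸ nilradical A) ≃+* (B ⧸ nilradical B)) := by
  refine ⟨Ideal.quotientEquiv (nilradical A) (nilradical B) e ?_⟩
  rw [Ideal.map_comap_of_equiv]
  change nilradical B = Ideal.comap _ (nilradical A)
  rw [nilradical, nilradical, Ideal.comap_radical, Ideal.zero_eq_bot, Ideal.zero_eq_bot,
    Ideal.comap_bot_of_injective _ e.symm.injective]

/-- Transport of weak resolutions of the reduced spectra along a ring isomorphism. [folklore] -/
theorem hasResolution_Spec_quotientNilradical_of_ringEquiv {A B : Type u} [CommRing A]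
    [CommRing B] (e : A ≃+* B) (h : Scheme.HasResolution (Spec (.of (A ⧸ nilradical A)))) :
    Scheme.HasResolution (Spec (.of (B ⧸ nilradical B))) := by
  obtain ⟨e'⟩ := nonempty_quotientNilradical_equiv_of_ringEquiv e
  exact Scheme.HasResolution.of_iso (Spec.map e'.symm.toCommRingCatIso.hom) h

end Reduced

/-! ## Translation by `p`-th powers: `A_a ≅ A_{a + b^p}` -/

section Translate

variable {p : ℕ} [hp : Fact p.Prime] {R : Type u} [CommRing R] [CharP R p]

/-- `(T - b)^p - a = T^p - (a + b^p)` in `R[T]`, characteristic `p`. [folklore] -/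
theorem X_pow_sub_C_comp_X_sub_C (a b : R) :
    (X ^ p - C a).comp (X - C b) = X ^ p - C (a + b ^ p) := by
  rw [sub_comp, X_pow_comp, C_comp, sub_pow_char, ← C_pow, map_add]
  ring

/-- `(T + b)^p - (a + b^p) = T^p - a` in `R[T]`, characteristic `p`. [folklore] -/
theorem X_pow_sub_C_add_comp_X_add_C (a b : R) :
    (X ^ p - C (a + b ^ p)).comp (X + C b) = X ^ p - C a := by
  rw [sub_comp, X_pow_comp, C_comp, add_pow_char, ← C_pow, map_add]
  ring

/-- The class of `T - b` in `R[T]/(T^p - (a + b^p))` is a `p`-th root of `a`. [folklore] -/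
theorem aeval_root_sub_X_pow_sub_C (a b : R) :
    aeval (AdjoinRoot.root (X ^ p - C (a + b ^ p)) - algebraMap R _ b) (X ^ p - C a) = 0 := by
  have h : AdjoinRoot.root (X ^ p - C (a + b ^ p)) - algebraMap R _ b =
      aeval (AdjoinRoot.root (X ^ p - C (a + b ^ p))) (X - C b) := by
    rw [map_sub (aeval _), aeval_X, aeval_C]
  rw [h, ← aeval_comp, X_pow_sub_C_comp_X_sub_C, AdjoinRoot.aeval_eq, AdjoinRoot.mk_self]

/-- The class of `T + b` in `R[T]/(T^p - a)` is a `p`-th root of `a + b^p`. [folklore] -/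
theorem aeval_root_add_X_pow_sub_C (a b : R) :
    aeval (AdjoinRoot.root (X ^ p - C a) + algebraMap R _ b) (X ^ p - C (a + b ^ p)) = 0 := by
  have h : AdjoinRoot.root (X ^ p - C a) + algebraMap R _ b =
      aeval (AdjoinRoot.root (X ^ p - C a)) (X + C b) := by
    rw [map_add (aeval _), aeval_X, aeval_C]
  rw [h, ← aeval_comp, X_pow_sub_C_add_comp_X_add_C, AdjoinRoot.aeval_eq, AdjoinRoot.mk_self]

/-- **Translation by `p`-th powers.** In characteristic `p`, `R[T]/(T^p - a) ≃ₐ[R]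
R[T]/(T^p - (a + b^p))` (`T ↦ T - b`). [folklore] -/
theorem nonempty_adjoinRootAlgEquivOfAddPow (a b : R) :
    Nonempty (AdjoinRoot (X ^ p - C a) ≃ₐ[R] AdjoinRoot (X ^ p - C (a + b ^ p))) := by
  let φ : AdjoinRoot (X ^ p - C a) →ₐ[R] AdjoinRoot (X ^ p - C (a + b ^ p)) :=
    AdjoinRoot.liftAlgHom (X ^ p - C a) (Algebra.ofId R _)
      (AdjoinRoot.root (X ^ p - C (a + b ^ p)) - algebraMap R _ b)
      (by exact aeval_root_sub_X_pow_sub_C a b)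
  let ψ : AdjoinRoot (X ^ p - C (a + b ^ p)) →ₐ[R] AdjoinRoot (X ^ p - C a) :=
    AdjoinRoot.liftAlgHom (X ^ p - C (a + b ^ p)) (Algebra.ofId R _)
      (AdjoinRoot.root (X ^ p - C a) + algebraMap R _ b)
      (by exact aeval_root_add_X_pow_sub_C a b)
  have hφ : φ (AdjoinRoot.root (X ^ p - C a)) =
      AdjoinRoot.root (X ^ p - C (a + b ^ p)) - algebraMap R _ b :=
    AdjoinRoot.liftAlgHom_root _ _ _ _
  have hψ : ψ (AdjoinRoot.root (X ^ p - C (a + b ^ p))) =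
      AdjoinRoot.root (X ^ p - C a) + algebraMap R _ b :=
    AdjoinRoot.liftAlgHom_root _ _ _ _
  refine ⟨AlgEquiv.ofAlgHom φ ψ ?_ ?_⟩
  · apply AdjoinRoot.algHom_ext
    rw [AlgHom.comp_apply, hψ, map_add φ, hφ, AlgHom.commutes, sub_add_cancel, AlgHom.id_apply]
  · apply AdjoinRoot.algHom_ext
    rw [AlgHom.comp_apply, hφ, map_sub ψ, hψ, AlgHom.commutes, add_sub_cancel_right,
      AlgHom.id_apply]

/-- **The local model is invariant under `a ↦ a + b^p`**: the reduced models of `t^p = a` and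
`t^p = a + b^p` over `R` (characteristic `p`) have the same resolution problem. [folklore] -/
theorem hasResolution_localModel_iff_of_addPow (a b : R) :
    Scheme.HasResolution (Spec (.of
      (AdjoinRoot (X ^ p - C a) ⧸ nilradical (AdjoinRoot (X ^ p - C a))))) ↔
    Scheme.HasResolution (Spec (.of
      (AdjoinRoot (X ^ p - C (a + b ^ p)) ⧸
        nilradical (AdjoinRoot (X ^ p - C (a + b ^ p)))))) := by
  obtain ⟨e⟩ := nonempty_adjoinRootAlgEquivOfAddPow (p := p) a b
  exact ⟨hasResolution_Spec_quotientNilradical_of_ringEquiv e.toRingEquiv,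
    hasResolution_Spec_quotientNilradical_of_ringEquiv e.toRingEquiv.symm⟩

end Translate

/-! ## Scaling by powers of units: `A_a ≅ A_{uⁿ a}` -/

section Scale

variable {R : Type u} [CommRing R]

/-- `(c T)ⁿ - cⁿ a = cⁿ (Tⁿ - a)` in `R[T]`. [folklore] -/
theorem X_pow_sub_C_mul_comp_C_mul_X (a c : R) (n : ℕ) :
    (X ^ n - C (c ^ n * a)).comp (C c * X) = C (c ^ n) * (X ^ n - C a) := by
  rw [sub_comp, X_pow_comp, C_comp, mul_pow, ← C_pow, map_mul]
  ring

/-- If `cⁿ a' = a`, the class of `c T` in `R[T]/(Tⁿ - a')` is an `n`-th root of `a`.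
[folklore] -/
theorem aeval_C_mul_root_X_pow_sub_C (a a' c : R) (n : ℕ) (h : c ^ n * a' = a) :
    aeval (algebraMap R _ c * AdjoinRoot.root (X ^ n - C a')) (X ^ n - C a) = 0 := by
  have h1 : algebraMap R _ c * AdjoinRoot.root (X ^ n - C a') =
      aeval (AdjoinRoot.root (X ^ n - C a')) (C c * X) := by
    rw [map_mul (aeval _), aeval_X, aeval_C]
  rw [h1, ← aeval_comp, ← h, X_pow_sub_C_mul_comp_C_mul_X, map_mul (aeval _),
    AdjoinRoot.aeval_eq (f := X ^ n - C a') (X ^ n - C a'), AdjoinRoot.mk_self, mul_zero]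

/-- **Scaling by powers of units.** For a unit `u` of `R` and any exponent `n`,
`R[T]/(Tⁿ - a) ≃ₐ[R] R[T]/(Tⁿ - uⁿ a)` (`T ↦ u⁻¹ T`). [folklore] -/
theorem nonempty_adjoinRootAlgEquivOfUnitMul (a : R) (u : Rˣ) (n : ℕ) :
    Nonempty (AdjoinRoot (X ^ n - C a) ≃ₐ[R] AdjoinRoot (X ^ n - C ((u : R) ^ n * a))) := by
  -- `a = (u⁻¹)ⁿ (uⁿ a)`
  have hinv : ((u⁻¹ : Rˣ) : R) ^ n * ((u : R) ^ n * a) = a := by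
    rw [← mul_assoc, ← mul_pow, Units.inv_mul, one_pow, one_mul]
  let φ : AdjoinRoot (X ^ n - C a) →ₐ[R] AdjoinRoot (X ^ n - C ((u : R) ^ n * a)) :=
    AdjoinRoot.liftAlgHom (X ^ n - C a) (Algebra.ofId R _)
      (algebraMap R _ ((u⁻¹ : Rˣ) : R) * AdjoinRoot.root (X ^ n - C ((u : R) ^ n * a)))
      (by exact aeval_C_mul_root_X_pow_sub_C a ((u : R) ^ n * a) ((u⁻¹ : Rˣ) : R) n hinv)
  let ψ : AdjoinRoot (X ^ n - C ((u : R) ^ n * a)) →ₐ[R] AdjoinRoot (X ^ n - C a) :=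
    AdjoinRoot.liftAlgHom (X ^ n - C ((u : R) ^ n * a)) (Algebra.ofId R _)
      (algebraMap R _ (u : R) * AdjoinRoot.root (X ^ n - C a))
      (by exact aeval_C_mul_root_X_pow_sub_C ((u : R) ^ n * a) a (u : R) n rfl)
  have hφ : φ (AdjoinRoot.root (X ^ n - C a)) =
      algebraMap R _ ((u⁻¹ : Rˣ) : R) * AdjoinRoot.root (X ^ n - C ((u : R) ^ n * a)) :=
    AdjoinRoot.liftAlgHom_root _ _ _ _
  have hψ : ψ (AdjoinRoot.root (X ^ n - C ((u : R) ^ n * a))) =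
      algebraMap R _ (u : R) * AdjoinRoot.root (X ^ n - C a) :=
    AdjoinRoot.liftAlgHom_root _ _ _ _
  refine ⟨AlgEquiv.ofAlgHom φ ψ ?_ ?_⟩
  · apply AdjoinRoot.algHom_ext
    rw [AlgHom.comp_apply, hψ, map_mul φ, hφ, AlgHom.commutes, ← mul_assoc, ← map_mul,
      Units.mul_inv, map_one, one_mul, AlgHom.id_apply]
  · apply AdjoinRoot.algHom_ext
    rw [AlgHom.comp_apply, hφ, map_mul ψ, hψ, AlgHom.commutes, ← mul_assoc, ← map_mul,
      Units.inv_mul, map_one, one_mul, AlgHom.id_apply]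

/-- **The local model is invariant under `a ↦ uⁿ a` for units `u`**: the reduced models of
`tⁿ = a` and `tⁿ = uⁿ a` over `R` have the same resolution problem. [folklore] -/
theorem hasResolution_localModel_iff_of_unitMul (a : R) (u : Rˣ) (n : ℕ) :
    Scheme.HasResolution (Spec (.of
      (AdjoinRoot (X ^ n - C a) ⧸ nilradical (AdjoinRoot (X ^ n - C a))))) ↔
    Scheme.HasResolution (Spec (.of
      (AdjoinRoot (X ^ n - C ((u : R) ^ n * a)) ⧸
        nilradical (AdjoinRoot (X ^ n - C ((u : R) ^ n * a)))))) := by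
  obtain ⟨e⟩ := nonempty_adjoinRootAlgEquivOfUnitMul a u n
  exact ⟨hasResolution_Spec_quotientNilradical_of_ringEquiv e.toRingEquiv,
    hasResolution_Spec_quotientNilradical_of_ringEquiv e.toRingEquiv.symm⟩

end Scale

end Summit.ResolutionOfSingularities.ResolutionOfSingularities.Theorems
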